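import Summits.AnomalousDissipation.AnomalousDissipation.Theses.DyadicWallCascade

/-!
# Sketch (crux-ideate round 2, ideator 5) — crux `DyadicWallCascade.ViscousContinuation`
(stmt-AnomalousDissipation-17917)

Statements only (no proofs required at this stage; every `def` is a `Prop`, the two reductions
at the end are one-line logic and ARE proved).  Two cards:

* `screened-cell-attractor` — §1–§3: the Brinkman-SCREENED truncations (`IsScreenedTruncation`),
  their exact energy budget (`ScreenBudget`, Lemma 0), the family property that carries the open
  content (`ScreenedFamily` = K-uniform bound + mesoscale attraction to the GIVEN hierarchy), the
  compactness/blow-up assembly (`AssemblyFromScreens`, first lemma of the line, L-size, standard),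
  and the line `ViscousContinuation_of_screens`.
* `wall-homogenised-weak-euler` — §4: the POINT-REFLECTED hierarchy (`V♭ X = -V (-X)` below the
  plane: the cascade upside down and turned by `π`) is a bounded steady WEAK Euler solution on all of
  `ℝ³` (`GlobalWeakHierarchy`, `GlobalWeakOfHierarchy` = first lemma), and the vacuity transfer
  `ViscousContinuation_of_rigidity`.  (Remark `mirror_needs_zero_stress`: the plain mirror extension
  is a weak solution iff the hierarchy's Reynolds stress `⟨V₂ V_h⟩` vanishes.)
-/

set_option linter.dupNamespace false
set_option linter.unusedVariables false

noncomputable section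

open scoped BigOperators Topology
open Filter Set MeasureTheory
open Summit.AnomalousDissipation.AnomalousDissipation.Theses.DyadicWallCascade

namespace Summit.AnomalousDissipation.AnomalousDissipation.Cruxes.ViscousContinuation.SketchK5

/-- Shorthand for `ℝ³`. -/
abbrev E3 : Type := EuclideanSpace ℝ (Fin 3)

/-- Standard basis vector. -/
def e (i : Fin 3) : E3 := EuclideanSpace.single i (1 : ℝ)

/-- The mirror `z ↦ -z` acting on points and on vectors. -/
def σ (X : E3) : E3 := X - (2 * X 2) • e 2

/-- The hierarchy clause block of crux #2, verbatim (= `Disproof.HierarchyBody`). -/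
def HierarchyBody (V : E3 → E3) (Q : E3 → ℝ) (C F : ℝ) : Prop :=
  let H : Set (EuclideanSpace ℝ (Fin 3)) := {X | 0 < X 2}
  let e : Fin 3 → EuclideanSpace ℝ (Fin 3) := fun i => EuclideanSpace.single i (1 : ℝ)
  let pt : ℝ × ℝ → EuclideanSpace ℝ (Fin 3) := fun q => !₂[q.1, q.2, (1 : ℝ)]
  ContDiffOn ℝ ((⊤ : ℕ∞) : WithTop ℕ∞) V H ∧ ContDiffOn ℝ ((⊤ : ℕ∞) : WithTop ℕ∞) Q H ∧
  (∀ X ∈ H, ‖V X‖ ≤ C ∧ |Q X| ≤ C) ∧ (∀ X ∈ H, ∑ i : Fin 3, (fderiv ℝ V X (e i)) i = 0) ∧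
  (∀ X ∈ H, (fderiv ℝ V X) (V X) + gradient Q X = 0) ∧
  (∀ X ∈ H, V ((2 : ℝ) • X) = V X ∧ Q ((2 : ℝ) • X) = Q X) ∧
  (∀ X : EuclideanSpace ℝ (Fin 3), 1 ≤ X 2 → X 2 ≤ 2 →
    V (X + e 0) = V X ∧ V (X + e 1) = V X ∧ Q (X + e 0) = Q X ∧ Q (X + e 1) = Q X) ∧
  (∫ q in Set.Icc (0 : ℝ) 1 ×ˢ Set.Icc (0 : ℝ) 1, (V (pt q)) 2 = 0) ∧ F ≠ 0 ∧
  (∫ q in Set.Icc (0 : ℝ) 1 ×ˢ Set.Icc (0 : ℝ) 1, (V (pt q)) 2 * (‖V (pt q)‖ ^ 2 / 2 + Q (pt q)) = F)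

theorem halfSpaceHierarchy_iff : HalfSpaceHierarchy ↔ ∃ V Q C F, HierarchyBody V Q C F := Iff.rfl

/-! ## §1 The screened truncations (card `screened-cell-attractor`) -/

/-- Mirror extension of a half-space field to all of `ℝ³` (vector parity: `V (σ X) = σ (V X)`). -/
def mirrorExt (V : E3 → E3) (X : E3) : E3 := if 0 ≤ X 2 then V X else σ (V (σ X))

/-- Mirror extension of a scalar (even). -/
def mirrorExtS (Q : E3 → ℝ) (X : E3) : ℝ := if 0 ≤ X 2 then Q X else Q (σ X)

/-- **The screened truncation at level `K`** (in `W`-units, `ν = 1`, `L = 2^K`): a smooth pair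
`(W, P)` on `ℝ³`, mirror-symmetric, `L`-periodic horizontally, `4L`-periodic vertically (with the
mirror parity this makes `X₂ = 0` and `X₂ = ±2L` exact slip planes — a CLOSED cell, no inflow
boundary, no lid data), divergence free, solving steady Navier–Stokes with the BRINKMAN SCREEN
force `(λ/L) χ(X₂/L) (V♯ − W)` that relaxes `W` towards the mirror-extended hierarchy `V♯` on the
band `L ≤ |X₂| ≤ 3L/2` (`χ` vanishes on `|t| < 1` and on `3/2 < |t| ≤ 2`; the plenum
`3L/2 < |X₂| < 2L` is free).  The force is recorded as a `4L`-periodic field `G` agreeing with the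
screen formula on the fundamental vertical period. -/
def IsScreenedTruncation (V : E3 → E3) (lam : ℝ) (χ : ℝ → ℝ) (K : ℕ) (W : E3 → E3) (P : E3 → ℝ) : Prop :=
  let L : ℝ := (2 : ℝ) ^ K
  ContDiff ℝ ((⊤ : ℕ∞) : WithTop ℕ∞) W ∧ ContDiff ℝ ((⊤ : ℕ∞) : WithTop ℕ∞) P ∧
  (∀ X, W (σ X) = σ (W X) ∧ P (σ X) = P X) ∧
  (∀ X, W (X + L • e 0) = W X ∧ W (X + L • e 1) = W X ∧ P (X + L • e 0) = P X ∧ P (X + L • e 1) = P X) ∧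
  (∀ X, W (X + (4 * L) • e 2) = W X ∧ P (X + (4 * L) • e 2) = P X) ∧
  (∀ X, ∑ i : Fin 3, (fderiv ℝ W X (e i)) i = 0) ∧
  ∃ G : E3 → E3,
    (∀ X, |X 2| ≤ 2 * L → G X = (lam / L * χ (X 2 / L)) • (mirrorExt V X - W X)) ∧
    (∀ X, G (X + (4 * L) • e 2) = G X) ∧
    (∀ X, (fderiv ℝ W X) (W X) + gradient P X = (∑ i : Fin 3, fderiv ℝ (fun Y => fderiv ℝ W Y (e i)) X (e i)) + G X)

/-- Admissible screen profiles: smooth, non-negative, not identically zero, supported in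
`1 ≤ |t| ≤ 3/2` within `|t| ≤ 2`, even. -/
def IsScreenProfile (χ : ℝ → ℝ) : Prop :=
  ContDiff ℝ ((⊤ : ℕ∞) : WithTop ℕ∞) χ ∧ (∀ t, 0 ≤ χ t) ∧ (∀ t, χ (-t) = χ t) ∧
  (∀ t, |t| < 1 → χ t = 0) ∧ (∀ t, 3 / 2 < |t| → |t| ≤ 2 → χ t = 0) ∧ χ (5 / 4) = 1

/-- **Lemma 0 — the exact energy budget of a screened truncation** (per fundamental cell
`[0,L]² × [−2L, 2L]`): dissipation + `(λ/L) ∫ χ |W − V♯/2|² = (λ/4L) ∫ χ |V♯|²`.  In particular the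
dissipation and `∫ χ |W|²` on the screen are bounded A PRIORI by the screen data alone (no lid
pressure, no Saint-Venant estimate; answers NegativeNotes-r1-k2 N7 / r1-k1 N1).  Proof: multiply
the momentum equation by `W`, integrate over the cell, periodicity + slip parity kill every
boundary term, `∫ (W·∇)W·W = ∫ ∇P·W = 0`, and complete the square in the screen term.  [M in Lean:
IBP on a periodic box for `fderiv`-level fields.] -/
def ScreenBudget : Prop :=
  ∀ (V : E3 → E3) (lam : ℝ) (χ : ℝ → ℝ) (K : ℕ) (W : E3 → E3) (P : E3 → ℝ),
    IsScreenProfile χ → IsScreenedTruncation V lam χ K W P →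
    let L : ℝ := (2 : ℝ) ^ K
    let cell : Set E3 := {X | 0 ≤ X 0 ∧ X 0 ≤ L ∧ 0 ≤ X 1 ∧ X 1 ≤ L ∧ |X 2| ≤ 2 * L}
    (∫ X in cell, ∑ i : Fin 3, ‖fderiv ℝ W X (e i)‖ ^ 2) +
        lam / L * ∫ X in cell, χ (X 2 / L) * ‖W X - (1 / 2 : ℝ) • mirrorExt V X‖ ^ 2 =
      lam / (4 * L) * ∫ X in cell, χ (X 2 / L) * ‖mirrorExt V X‖ ^ 2

/-- **S1 — screened truncations exist at every level** (free: steady forced Navier–Stokes on a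
closed periodic cell in a symmetry class; Galerkin/Leray–Schauder + the coercive bound of Lemma 0;
smooth by elliptic regularity).  [M/L; classical, e.g. Temam 1977 Ch. II Thm 1.2 shape.] -/
def ScreensExist : Prop :=
  ∀ (V : E3 → E3) (Q : E3 → ℝ) (C F : ℝ) (lam : ℝ) (χ : ℝ → ℝ), HierarchyBody V Q C F → 0 < lam →
    IsScreenProfile χ → ∀ K : ℕ, ∃ (W : E3 → E3) (P : E3 → ℝ), IsScreenedTruncation V lam χ K W P

/-! ## §2 The family property carrying the open content -/

/-- **`ScreenedFamily V Q`** — along `L = 2^K` SOME screened truncations `(W_K, P_K)` (one screen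
profile `χ`, one strength `λ`) are (B1) bounded by `M` on the core `|X₂| ≤ 2^K` uniformly in `K`
(no flywheel), and (B2) attracted to the given hierarchy at every FIXED mesoscale once the screen
is far enough above it: for each `m` there is `K₀` with
`|W_K (2^m X) − V X| + |P_K (2^m X) − Q X| ≤ η m` on the band for all `K ≥ K₀`, and `η m → 0`
(down-scale attraction of `V`: the screen itself misses `V` by `O(1/λ)` for ever — it must do work —
so the clause must NOT be asked on bands adjacent to the screen; what matters is that the screen's
imprint has decayed by the time one is `K − K₀(m)` octaves below it, leaving only the intrinsic
blow-down defect `η m ≥ c 2^{-m}` of Disproof §5).  This is the honest open stub of the line: STRONGER than `ViscousWallProfile`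
(it is not implied by it without a uniform invertibility of the linearisation at `W`), about
canonical, computable objects with an exact budget. -/
def ScreenedFamily (V : E3 → E3) (Q : E3 → ℝ) : Prop :=
  ∃ (lam : ℝ) (χ : ℝ → ℝ) (W : ℕ → E3 → E3) (P : ℕ → E3 → ℝ) (M : ℝ) (η : ℕ → ℝ),
    0 < lam ∧ IsScreenProfile χ ∧ Tendsto η atTop (𝓝 0) ∧
    (∀ K, IsScreenedTruncation V lam χ K (W K) (P K)) ∧
    (∀ K (X : E3), |X 2| ≤ (2 : ℝ) ^ K → ‖W K X‖ ≤ M ∧ |P K X| ≤ M) ∧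
    (∀ m : ℕ, ∃ K₀ : ℕ, ∀ K : ℕ, K₀ ≤ K → ∀ X : E3, 1 ≤ X 2 → X 2 ≤ 2 →
      ‖W K ((2 : ℝ) ^ m • X) - V X‖ ≤ η m ∧ |P K ((2 : ℝ) ^ m • X) - Q X| ≤ η m)

/-- **S2 (OPEN — the crux's existence content in screened form)**: some half-space hierarchy is a
down-scale attractor of its screened cells.  Why it might fail: every hierarchy may be a REPELLER
of the octave map in some symmetric sector (partition loop, TRIAGE r1-1 P4 / r1-3 E2′), or the
screened steady branch may develop flywheels (`sup |W_K| ~ 2^{K/2}` is all the budget forbids). -/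
def SomeHierarchyAttracts : Prop :=
  HalfSpaceHierarchy → ∃ (V : E3 → E3) (Q : E3 → ℝ) (C F : ℝ), HierarchyBody V Q C F ∧ ScreenedFamily V Q

/-! ## §3 The assembly (first lemma of the line) -/

/-- **S3 — FIRST LEMMA of the line (compactness / blow-up assembly, L-size, standard tools):**
a hierarchy with a screened family has a viscous wall profile.  Proof sketch: the `W_K` are
force-free steady NS at `ν = 1` on `|X₂| < 2^K` and bounded by `M` there, so interior regularity of
bounded steady NS (tree: `IsSteadyClassicalNS.analyticOnNhd_of_bounded` shape; locally and
without any pressure or energy hypothesis: take `curl`, `Δω = curl div (W ⊗ W)`, so `sup |W| ≤ M`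
on `B₂` bounds `ω` in every `L^q(B₁)` modulo a harmonic part controlled by its `W^{-1,q}` norm,
then div–curl and bootstrap) bounds every `C^k` norm on compacts uniformly in `K`; Arzelà–Ascoli + a diagonal
subsequence give `(W_K, P_K) → (W, P)` in `C^k_loc(ℝ³)`; the limit is smooth, bounded by `M`,
mirror-symmetric, divergence free, force-free steady NS everywhere (the screen recedes to
infinity); and for fixed `m` and band point `X`, `‖W (2^m X) − V X‖ = lim_K ‖W_K (2^m X) − V X‖ ≤ η m`,
which is the blow-down clause.  The conclusion is `ViscousWallProfile` BY NAME. -/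
def AssemblyFromScreens : Prop :=
  ∀ (V : E3 → E3) (Q : E3 → ℝ) (C F : ℝ), HierarchyBody V Q C F → ScreenedFamily V Q → ViscousWallProfile

/-- The line, kernel-checked composition: S2 → S3 → crux (S1 and Lemma 0 are the engine of S2,
not hypotheses of the composition). -/
theorem ViscousContinuation_of_screens (h2 : SomeHierarchyAttracts) (h3 : AssemblyFromScreens) :
    ViscousContinuation := by
  intro hH
  obtain ⟨V, Q, C, F, hB, hS⟩ := h2 hH
  exact h3 V Q C F hB hS

/-! ## §4 The wall-homogenised weak Euler solution (card `wall-homogenised-weak-euler`) -/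

/-- Point-reflected extension of a half-space field to all of `ℝ³`: below the plane the field is the
pushforward of `V` by the inversion `X ↦ -X` (an isometry), `V♭ X = -V (-X)`; steady Euler is
invariant, and — unlike the mirror image — the TANGENTIAL momentum flux `V₂ V_h` keeps its
homogenised value across the plane. -/
def pointExt (V : E3 → E3) (X : E3) : E3 := if 0 ≤ X 2 then V X else -V (-X)

/-- Point-reflected extension of the pressure (a scalar: `Q♭ X = Q (-X)` below the plane). -/
def pointExtS (Q : E3 → ℝ) (X : E3) : ℝ := if 0 ≤ X 2 then Q X else Q (-X)

/-- **`GlobalWeakHierarchy`** — a half-space hierarchy whose point-reflected extension `(V♭, Q♭)`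
is a bounded steady WEAK Euler solution on ALL of `ℝ³` (momentum and incompressibility in the sense
of distributions, tested against smooth compactly supported fields; no pressure gauge is needed —
constants test to zero against `div φ`).  Its Duchon–Robert energy defect is the flat measure
`2|F| · H² ⌊ {X₂ = 0}` up to sign (dissipative for `F < 0`, anti-dissipative for the reversed
witness `V ↦ -V`), it is `C^∞` off the plane and discretely self-similar about the origin. -/
def GlobalWeakHierarchy : Prop :=
  ∃ (V : E3 → E3) (Q : E3 → ℝ) (C F : ℝ), HierarchyBody V Q C F ∧
    (∀ φ : E3 → E3, ContDiff ℝ ((⊤ : ℕ∞) : WithTop ℕ∞) φ → HasCompactSupport φ →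
      ∫ X, ((∑ i : Fin 3, ∑ j : Fin 3, (pointExt V X) i * (pointExt V X) j * (fderiv ℝ φ X (e j)) i) +
        (pointExtS Q X) * ∑ i : Fin 3, (fderiv ℝ φ X (e i)) i) = 0) ∧
    (∀ ψ : E3 → ℝ, ContDiff ℝ ((⊤ : ℕ∞) : WithTop ℕ∞) ψ → HasCompactSupport ψ →
      ∫ X, (∑ i : Fin 3, (pointExt V X) i * (fderiv ℝ ψ X) (e i)) = 0)

/-- **FIRST LEMMA of card B (provable, M/L): every half-space hierarchy is a global weak
hierarchy.**  Proof sketch: on `z > ε` and `z < -ε` the pair is classical (Euler is invariant under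
the isometry `X ↦ -X`), so after integration by parts the defect of the weak formulation is the sum
of the two slice terms `B₊ = -∫_{z=ε} (V₂ V·φ + Q φ₂)` and
`B₋ = +∫_{z=-ε} (V♭₂ V♭·φ + Q♭ φ₂) = ∫ (V₂V·φ(-x,-y,-ε) + Q φ₂(-x,-y,-ε))(x,y,ε)` (change of
variables `(x, y) ↦ (-x, -y)` on the slice).  The slice `{z = ε}` is `2^{-k}`-periodic with
`k ~ log₂(1/ε)` (band clause + dilation), so the bounded traces `V₂V_h`, `V₂² + Q`, `V₂` converge
weakly-* to their cell MEANS `τ_h`, `M`, `0`, and the means are height-independent conserved fluxes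
(horizontal/vertical momentum and mass per unit area of a band-periodic steady Euler flow); hence
`B₊ + B₋ → τ_h · ∫ (φ_h(-x,-y,0) - φ_h(x,y,0)) + M ∫ (φ₂(-x,-y,0) - φ₂(x,y,0)) = 0`, and the
divergence defect `→ -2⟨V₂⟩ ∫ ψ(·,·,0) = 0` by ZERO MASS FLUX.  Uses boundedness, dilation, band
periodicity, zero mass flux and the momentum equation (the fluxes `τ_h, M` are momentum facts). -/
def GlobalWeakOfHierarchy : Prop := HalfSpaceHierarchy → GlobalWeakHierarchy

/-- **Remark (sharpness; why the extension must be the point reflection):** with the plain MIRROR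
extension `mirrorExt V` (vector parity `V₂` odd, `V_h` even) the tangential momentum flux `V₂V_h` is
odd across the plane and the weak formulation acquires the defect `-2 τ_h · ∫ φ_h(·,·,0)`: the
mirror image is a global weak solution iff the hierarchy's homogenised Reynolds stress
`τ_h = ⟨V₂ V_h⟩` vanishes — the normalisation that the VISCOUS profile forces on its blow-down
(sibling `stub_zeroStress`) but that is free at the Euler level. Typed as the statement that zero
stress makes the mirror extension weak too. -/
def MirrorNeedsZeroStress : Prop :=
  ∀ (V : E3 → E3) (Q : E3 → ℝ) (C F : ℝ), HierarchyBody V Q C F →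
    (let pt : ℝ × ℝ → E3 := fun q => !₂[q.1, q.2, (1 : ℝ)]
     (∫ q in Set.Icc (0 : ℝ) 1 ×ˢ Set.Icc (0 : ℝ) 1, (V (pt q)) 2 * (V (pt q)) 0 = 0) ∧
     (∫ q in Set.Icc (0 : ℝ) 1 ×ˢ Set.Icc (0 : ℝ) 1, (V (pt q)) 2 * (V (pt q)) 1 = 0)) →
    (∀ φ : E3 → E3, ContDiff ℝ ((⊤ : ℕ∞) : WithTop ℕ∞) φ → HasCompactSupport φ →
      ∫ X, ((∑ i : Fin 3, ∑ j : Fin 3, (mirrorExt V X) i * (mirrorExt V X) j * (fderiv ℝ φ X (e j)) i) +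
        (mirrorExtS Q X) * ∑ i : Fin 3, (fderiv ℝ φ X (e i)) i) = 0)

/-- **The rigidity target (OPEN; = the (h, D) = (0, 2) Frisch–Parisi corner for STEADY weak Euler
solutions smooth off a plane):** no global weak hierarchy exists.  Equivalent to `¬HalfSpaceHierarchy`
given `GlobalWeakOfHierarchy` (the converse restriction is trivial), but posed in the class where
both flexibility (Choffrut–Székelyhidi stationary h-principle, rough everywhere) and rigidity
(De Rosa–Inversi BV, De Rosa–Drivas–Inversi support bounds, the 2-D stream-function proof) live. -/
def PlanarDefectRigidity : Prop := ¬ GlobalWeakHierarchy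

/-- The vacuity transfer, kernel-checked: rigidity of the global weak class settles the crux
(it refutes crux #2, which proves #3 — Disproof §1 `viscousContinuation_of_not_halfSpaceHierarchy`). -/
theorem ViscousContinuation_of_rigidity (h1 : GlobalWeakOfHierarchy) (h2 : PlanarDefectRigidity) :
    ViscousContinuation := fun hH => (h2 (h1 hH)).elim

end Summit.AnomalousDissipation.AnomalousDissipation.Cruxes.ViscousContinuation.SketchK5

end
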